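import Summits.RiemannHypothesis.RiemannHypothesis.Theorems.SignConeFakeWeightReduction

/-!
# The unit-slack sign-cone inequality at a finite cutoff: converse of `SignConeDuality`, first-prime form with slack
(route `SignCone`, item stmt-RiemannHypothesis-16302 `SignConeOscillatory`)

With UNIT SLACK the bookkeeping of `SignConeFakeWeightReduction.lean` gives the route's inequality
`-Re F(0) ≤ Re W_ar(F)` itself at a fixed cutoff `b`:

* `neg_re_apply_zero_le_re_weilArchPolar_of_fakeWeight_unitSlack` — if ONE non-negative fake weight `c` has
  `-‖g‖₂² ≤ Re (W_ar(g ⋆ g̃) - P_c(g ⋆ g̃))` on the Weil tests supported in `[-b, b]` (literally the antecedent of the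
  route item `ConeMagnification` at cutoff `b`), then the unit-slack sign-cone inequality holds on the node-nonnegative
  cone at cutoff `b` — the converse of the crux `SignConeDuality`, cutoff by cutoff;
* `neg_re_apply_zero_le_re_weilArchPolar_of_weilFirstPrimeQuadratic_ge_neg` — in first-prime form,
  `-‖g‖₂² ≤ E₂(g)` on `C(b)` suffices, using only the node `log 2`; this is a full unit weaker than `E₂ ≥ 0` and is the
  natural certificate target for pushing the unconditional range of item stmt-RiemannHypothesis-16302 beyond `563/1024`
  (`signConeOscillatory_upTo_of_weilFirstPrimeQuadratic_ge_neg`, `signConeOscillatory_upTo_of_fakeWeight_unitSlack`: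
  the item's body verbatim with the extra hypothesis `a ≤ b`).
-/

noncomputable section

-- `Summit.RiemannHypothesis.RiemannHypothesis.…` repeats a namespace component by design (D-0017 layout).
set_option linter.dupNamespace false

open scoped BigOperators ComplexConjugate
open Complex MeasureTheory Set Filter

namespace Summit.RiemannHypothesis.RiemannHypothesis.Theorems.SignCone

open Literature.NumberTheory.LFunctions
open Summit.RiemannHypothesis.RiemannHypothesis.Theorems.RuelleBandCofiniteCriticalLine

/-- `Re F(0) = Σᵢ ‖gᵢ‖₂²` for `F = Σᵢ gᵢ ⋆ g̃ᵢ`. [folklore] -/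
theorem re_apply_zero_eq_sum_weilNorm2Sq {k : ℕ} {g : Fin k → ℝ → ℂ} {F : ℝ → ℂ}
    (hF : F = fun t => ∑ i, weilConv (g i) (weilReflect (g i)) t) :
    (F 0).re = ∑ i, weilNorm2Sq (g i) := by
  rw [hF]
  simp only [Complex.re_sum, weilConv_weilReflect_apply_zero, Complex.ofReal_re]
  rfl

/-- **Converse of `SignConeDuality` (unit slack).** If a non-negative weight `c` has
`-‖g‖₂² ≤ Re (W_ar(g ⋆ g̃) - P_c(g ⋆ g̃))` for every Weil test `g` supported in `[-b, b]` (the antecedent of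
`ConeMagnification` at cutoff `b`), then `-Re F(0) ≤ Re W_ar(F)` for every node-nonnegative `F = Σᵢ gᵢ ⋆ g̃ᵢ` at
cutoff `b`. [folklore] -/
theorem neg_re_apply_zero_le_re_weilArchPolar_of_fakeWeight_unitSlack {b : ℝ} {c : ℕ → ℝ} (hc : ∀ n, 0 ≤ c n)
    (hW : ∀ g : ℝ → ℂ, IsWeilTest g → tsupport g ⊆ Icc (-b) b →
      -(∫ t, ‖g t‖ ^ 2) ≤ (weilPolarTerm (weilConv g (weilReflect g)) + weilArchTerm (weilConv g (weilReflect g)) -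
        ∑' n : ℕ, ((c n : ℝ) : ℂ) / (Real.sqrt n : ℂ) *
          (weilConv g (weilReflect g) (Real.log n) + weilConv g (weilReflect g) (-Real.log n))).re)
    {k : ℕ} {g : Fin k → ℝ → ℂ} {F : ℝ → ℂ} (hF : F = fun t => ∑ i, weilConv (g i) (weilReflect (g i)) t)
    (hg : ∀ i, IsWeilTest (g i)) (hsupp : ∀ i, tsupport (g i) ⊆ Icc (-b) b)
    (hn : ∀ n : ℕ, 2 ≤ n → 0 ≤ (F (Real.log n)).re) :
    -(F 0).re ≤ (weilPolarTerm F + weilArchTerm F).re := by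
  have hGi : ∀ i, IsWeilTest (weilConv (g i) (weilReflect (g i))) := fun i =>
    (hg i).weilConv (hg i).weilReflect
  have hFt : IsWeilTest F := by
    rw [hF]
    exact stub_branchesContinuous_isWeilTest_sum _ fun i _ => hGi i
  have hsym : ∀ t : ℝ, conj (F (-t)) = F t := by
    intro t
    simp only [hF, map_sum, conj_weilConv_weilReflect_neg]
  have h0 : 0 ≤ (F 0).re := re_apply_zero_nonneg hF
  have hA : weilPolarTerm F + weilArchTerm F =
      ∑ i, (weilPolarTerm (weilConv (g i) (weilReflect (g i))) +
        weilArchTerm (weilConv (g i) (weilReflect (g i)))) := by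
    rw [hF]
    exact weilArchPolar_finset_sum _ fun i _ => hGi i
  have hPc : (∑' n : ℕ, ((c n : ℝ) : ℂ) / (Real.sqrt n : ℂ) * (F (Real.log n) + F (-Real.log n))) =
      ∑ i, ∑' n : ℕ, ((c n : ℝ) : ℂ) / (Real.sqrt n : ℂ) *
        (weilConv (g i) (weilReflect (g i)) (Real.log n) +
          weilConv (g i) (weilReflect (g i)) (-Real.log n)) := by
    rw [← fakePrimeTerm_finset_sum c _ fun i _ => (hGi i).2]
    simp only [hF]
  have hPre := re_fakePrimeTerm_nonneg hc hFt.2 hsym h0 hn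
  have hsum : -(F 0).re ≤ ∑ i, ((weilPolarTerm (weilConv (g i) (weilReflect (g i))) +
      weilArchTerm (weilConv (g i) (weilReflect (g i)))) -
        ∑' n : ℕ, ((c n : ℝ) : ℂ) / (Real.sqrt n : ℂ) *
          (weilConv (g i) (weilReflect (g i)) (Real.log n) +
            weilConv (g i) (weilReflect (g i)) (-Real.log n))).re := by
    rw [re_apply_zero_eq_sum_weilNorm2Sq hF, ← Finset.sum_neg_distrib]
    exact Finset.sum_le_sum fun i _ => hW _ (hg i) (hsupp i)
  have key : (weilPolarTerm F + weilArchTerm F).re =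
      (∑ i, ((weilPolarTerm (weilConv (g i) (weilReflect (g i))) +
        weilArchTerm (weilConv (g i) (weilReflect (g i)))) -
          ∑' n : ℕ, ((c n : ℝ) : ℂ) / (Real.sqrt n : ℂ) *
            (weilConv (g i) (weilReflect (g i)) (Real.log n) +
              weilConv (g i) (weilReflect (g i)) (-Real.log n))).re) +
        (∑' n : ℕ, ((c n : ℝ) : ℂ) / (Real.sqrt n : ℂ) * (F (Real.log n) + F (-Real.log n))).re := by
    rw [hA, hPc, ← Complex.re_sum, ← Complex.add_re, Finset.sum_sub_distrib, sub_add_cancel]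
  rw [key]
  linarith

/-- **First-prime form with unit slack.** If `-‖g‖₂² ≤ E₂(g)` for every Weil test `g` supported in `[-b, b]`, then
`-Re F(0) ≤ Re W_ar(F)` for every `F = Σᵢ gᵢ ⋆ g̃ᵢ` with `tsupport gᵢ ⊆ [-b, b]` and `Re F(log 2) ≥ 0` (only the node
`log 2` is used). [folklore] -/
theorem neg_re_apply_zero_le_re_weilArchPolar_of_weilFirstPrimeQuadratic_ge_neg {b : ℝ}
    (hE : ∀ g : ℝ → ℂ, IsWeilTest g → tsupport g ⊆ Icc (-b) b → -weilNorm2Sq g ≤ weilFirstPrimeQuadratic g)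
    {k : ℕ} {g : Fin k → ℝ → ℂ} {F : ℝ → ℂ} (hF : F = fun t => ∑ i, weilConv (g i) (weilReflect (g i)) t)
    (hg : ∀ i, IsWeilTest (g i)) (hsupp : ∀ i, tsupport (g i) ⊆ Icc (-b) b)
    (h2 : 0 ≤ (F (Real.log 2)).re) : -(F 0).re ≤ (weilPolarTerm F + weilArchTerm F).re := by
  rw [re_weilArchPolar_eq_sum_weilFirstPrimeQuadratic_add hF hg, re_apply_zero_eq_sum_weilNorm2Sq hF,
    ← Finset.sum_neg_distrib]
  have h1 : ∑ i, -weilNorm2Sq (g i) ≤ ∑ i, weilFirstPrimeQuadratic (g i) :=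
    Finset.sum_le_sum fun i _ => hE _ (hg i) (hsupp i)
  have h3 : 0 ≤ Real.sqrt 2 * Real.log 2 * (F (Real.log 2)).re := by positivity
  linarith

/-- **`SignConeOscillatory` up to any cutoff `b` with `E₂ ≥ -‖·‖₂²` on `C(b)`** — the route item restricted to `a ≤ b`,
conditional on first-prime-form positivity WITH UNIT SLACK on `C(b)`: the certificate target for extending the
unconditional range of item stmt-RiemannHypothesis-16302 (body verbatim over Mathlib primitives). [folklore] -/
theorem signConeOscillatory_upTo_of_weilFirstPrimeQuadratic_ge_neg {b : ℝ}
    (hE : ∀ g : ℝ → ℂ, IsWeilTest g → tsupport g ⊆ Icc (-b) b → -weilNorm2Sq g ≤ weilFirstPrimeQuadratic g) :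
    ∀ a : ℝ, 0 < a → a ≤ b → ∀ (k : ℕ) (g : Fin k → ℝ → ℂ), (∀ i, (ContDiff ℝ ((⊤ : ℕ∞) : WithTop ℕ∞) (g i) ∧ HasCompactSupport (g i)) ∧ tsupport (g i) ⊆ Set.Icc (-a) a) → let F : ℝ → ℂ := fun t => ∑ i, MeasureTheory.convolution (g i) (fun u => (starRingEnd ℂ) ((g i) (-u))) (ContinuousLinearMap.mul ℂ ℂ) MeasureTheory.MeasureSpace.volume t; (∀ n : ℕ, 2 ≤ n → 0 ≤ (F (Real.log n)).re) → (∃ t : ℝ, Real.log 2 ≤ |t| ∧ (F t).re < 0) → let M : ℂ → ℂ := fun s => ∫ u : ℝ, F u * Complex.exp ((s - 1 / 2) * u); -(F 0).re ≤ (M 0 + M 1 + ((1 / (2 * Real.pi) : ℂ) * (∫ t : ℝ, M (1 / 2 + t * Complex.I) * ((Complex.digamma (1 / 4 + t / 2 * Complex.I)).re : ℂ)) - F 0 * (Real.log Real.pi : ℂ))).re := by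
  intro a _ha hab k g hg F hn _hosc M
  exact neg_re_apply_zero_le_re_weilArchPolar_of_weilFirstPrimeQuadratic_ge_neg (b := b) hE (g := g) (F := F) rfl
    (fun i => (hg i).1) (fun i => (hg i).2.trans (Icc_subset_Icc (neg_le_neg hab) hab)) (hn 2 le_rfl)

/-- **`SignConeOscillatory` up to any cutoff `b` carrying a unit-slack fake weight** — the route item restricted to
`a ≤ b`, conditional on the antecedent of `ConeMagnification` AT THE SINGLE CUTOFF `b` (body verbatim; this is the
converse of `SignConeDuality` restricted to the oscillatory class). [folklore] -/
theorem signConeOscillatory_upTo_of_fakeWeight_unitSlack {b : ℝ} {c : ℕ → ℝ} (hc : ∀ n, 0 ≤ c n)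
    (hW : ∀ g : ℝ → ℂ, IsWeilTest g → tsupport g ⊆ Icc (-b) b →
      -(∫ t, ‖g t‖ ^ 2) ≤ (weilPolarTerm (weilConv g (weilReflect g)) + weilArchTerm (weilConv g (weilReflect g)) -
        ∑' n : ℕ, ((c n : ℝ) : ℂ) / (Real.sqrt n : ℂ) *
          (weilConv g (weilReflect g) (Real.log n) + weilConv g (weilReflect g) (-Real.log n))).re) :
    ∀ a : ℝ, 0 < a → a ≤ b → ∀ (k : ℕ) (g : Fin k → ℝ → ℂ), (∀ i, (ContDiff ℝ ((⊤ : ℕ∞) : WithTop ℕ∞) (g i) ∧ HasCompactSupport (g i)) ∧ tsupport (g i) ⊆ Set.Icc (-a) a) → let F : ℝ → ℂ := fun t => ∑ i, MeasureTheory.convolution (g i) (fun u => (starRingEnd ℂ) ((g i) (-u))) (ContinuousLinearMap.mul ℂ ℂ) MeasureTheory.MeasureSpace.volume t; (∀ n : ℕ, 2 ≤ n → 0 ≤ (F (Real.log n)).re) → (∃ t : ℝ, Real.log 2 ≤ |t| ∧ (F t).re < 0) → let M : ℂ → ℂ := fun s => ∫ u : ℝ, F u * Complex.exp ((s - 1 /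 2) * u); -(F 0).re ≤ (M 0 + M 1 + ((1 / (2 * Real.pi) : ℂ) * (∫ t : ℝ, M (1 / 2 + t * Complex.I) * ((Complex.digamma (1 / 4 + t / 2 * Complex.I)).re : ℂ)) - F 0 * (Real.log Real.pi : ℂ))).re := by
  intro a _ha hab k g hg F hn _hosc M
  exact neg_re_apply_zero_le_re_weilArchPolar_of_fakeWeight_unitSlack (b := b) hc hW (g := g) (F := F) rfl
    (fun i => (hg i).1) (fun i => (hg i).2.trans (Icc_subset_Icc (neg_le_neg hab) hab)) hn

end Summit.RiemannHypothesis.RiemannHypothesis.Theorems.SignCone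

end
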